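import Literature.Geometry.Riemannian.WeightedHeatFlowAPriori
import Literature.Geometry.Lorentzian.CoordConjugateHeat
import HarnessLib

/-!
# The weighted heat flow from the linear heat-type Cauchy problem on closed manifolds:
# `carrilloNi_muEntropy_eq_log_shrinkerDensity` from the SAME analytic input as
# Perelman's no local collapsing theorem

`WeightedHeatFlowAPriori.lean` reduced the named fact
`carrilloNi_muEntropy_eq_log_shrinkerDensity` (Carrillo–Ni 2009, Cor. 4.1, closed case) to the
existence, for every smooth initial datum, of a solution smooth on `M × [0, ∞)` of the weighted
heat equation `∂ₜu = Δ_g u − g⁻¹(dV, du)` on a closed Riemannian manifold with an arbitrary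
model space. This file reduces that input further to EXACTLY the hypothesis `hLP` of
`perelman_noLocalCollapsing_of_linearHeat` (`PerelmanNoncollapsingLinearHeat.lean`): the
solvability, smooth on `M × [0, T]`, of the linear Cauchy problem `∂_s w = Δ_{h(s)} w − Q w`,
`w(0) = w₀`, for smooth data on closed manifolds modelled on `ℝ^m`. So both named facts now rest
on one and the same standard theorem of linear parabolic theory. PROVED here:

* `dalembertian_fun_mul` — the product rule `Δ(ab) = aΔb + bΔa + 2g⁻¹(da, db)` on a manifold
  (from the coordinate rule `MetricCoord.lapAt_mul` through the chart at the point);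
* `heatDrift_of_potential` — **conjugation by `e^{V/2}`**: if `w` solves
  `∂ₜw = Δw − (¼|∇V|² − ½ΔV) w` then `u = e^{V/2} w` solves `∂ₜu = Δu − g⁻¹(dV, du)`;
* `heatDrift_unique` — **uniqueness** of smooth solutions of `∂ₜu = Δu − g⁻¹(dV, du)` on
  `M × [0, T]` (weak maximum principle for `(u₁ − u₂)²`, Topping 2006, Thm. 3.1.1);
* `heatDrift_global_of_finite` — solutions on every `[0, T]` GLUE (by uniqueness) to a solution
  smooth on `M × [0, ∞)`;
* `heatDrift_finite_of_linearHeat` — the finite-time problem on a manifold with an arbitrary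
  finite-dimensional model space `E` from `hLP` on the same manifold re-modelled on
  `ℝ^{dim E}` (`I.transContinuousLinearEquiv e`, `PseudoRiemannianMetric.transportCLE`:
  same smooth functions, same Laplacian `dalembertian_transportCLE`);
* **`carrilloNi_muEntropy_eq_log_shrinkerDensity_of_linearHeat`** — the named fact from `hLP`;
* `heatDrift_finite_of_staticLinearHeat`,
  `carrilloNi_muEntropy_eq_log_shrinkerDensity_of_staticLinearHeat` — the same from the STATIC
  special case `h ≡ g` of `hLP` stated for an arbitrary model space (no re-modelling), the
  weakest form of the remaining input along this line.
* `carrilloNi_muEntropy_eq_log_shrinkerDensity_of_linearParabolic` — the same from the form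
  `hLH` of the linear theorem used by `perelman_noLocalCollapsing_of_linearParabolic_existence`
  (`∂ₛw = Δ_{h(s)} w + c w` for the one-sided `derivWithin`; `c = −Q`).

Theorems only; no definitions, no named facts; the named fact is NOT discharged (`hLP` — e.g.
A. Friedman, *Partial differential equations of parabolic type* (1964), Ch. 1, Thm. 10 and
Ch. 3, Thm. 7 with a partition of unity on the closed manifold; P. Topping, *Lectures on the
Ricci flow* (2006), Rem. 8.2.5 — is not in Mathlib or the tree).

## References

* [CarrilloNi2009] J. A. Carrillo, L. Ni, Comm. Anal. Geom. 17 (2009), §3–§4, Cor. 4.1.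
* P. Topping, *Lectures on the Ricci flow* (2006), Thm. 3.1.1, Rem. 8.2.5. [Topping2006]
* A. Friedman, *Partial differential equations of parabolic type*, Prentice-Hall 1964, Ch. 1.
  [Friedman1964]
-/

noncomputable section

open Bundle Set Function Module Filter Manifold MeasureTheory
open scoped ContDiff Topology

namespace Literature.Geometry.Riemannian

open Lorentzian Lorentzian.PseudoRiemannianMetric

universe u

/-! ### The product rule for `Δ_g` and the conjugation by `e^{V/2}` -/

section Conjugation

variable {E : Type*} [NormedAddCommGroup E] [NormedSpace ℝ E] [FiniteDimensional ℝ E]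
  {H : Type*} [TopologicalSpace H] {I : ModelWithCorners ℝ E H} [I.Boundaryless]
  {M : Type*} [TopologicalSpace M] [ChartedSpace H M] [IsManifold I ∞ M]
  (g : PseudoRiemannianMetric I ∞ E (TangentSpace I : M → Type _)) [g.HasLeviCivita]

omit [I.Boundaryless] [g.HasLeviCivita] in
/-- `g⁻¹(α, β + β') = g⁻¹(α, β) + g⁻¹(α, β')`. [folklore] -/
theorem _root_.Literature.Geometry.Lorentzian.PseudoRiemannianMetric.innerDual_add_right (x : M)
    (α β β' : Module.Dual ℝ (TangentSpace I x)) :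
    g.innerDual x α (β + β') = g.innerDual x α β + g.innerDual x α β' := by
  simp only [PseudoRiemannianMetric.innerDual, map_add]

/-- **The product rule for the Laplace–Beltrami operator**: for `a, b` of class `C²` at `x`,
`Δ_g(ab)(x) = a Δ_g b + b Δ_g a + 2 g⁻¹(da, db)` (the coordinate rule `MetricCoord.lapAt_mul`
read through the chart at `x`: `dalembertian_chartInv_eq`, `innerDual_chartInv_eq`).
[cite: Topping2006, proof of Prop. 8.2.6, (8.2.4)] -/
theorem dalembertian_fun_mul {a b : M → ℝ} {x : M} (ha : ContMDiffAt I 𝓘(ℝ, ℝ) 2 a x)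
    (hb : ContMDiffAt I 𝓘(ℝ, ℝ) 2 b x) :
    g.dalembertian (fun y ↦ a y * b y) x =
      a x * g.dalembertian b x + b x * g.dalembertian a x
        + 2 * g.innerDual x (mvfderiv I a x : TangentSpace I x →ₗ[ℝ] ℝ)
            (mvfderiv I b x : TangentSpace I x →ₗ[ℝ] ℝ) := by
  set G := chartRep I (fun _ ↦ g) x 0 with hGdef
  have hGm : MetricCoord.IsMetricOn G (extChartAt I x).target :=
    Lorentzian.OpensChart.isMetricOn_repr (val_chartPullback_eq_chartRep (fun _ : ℝ ↦ g) x 0)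
  have hu0 : extChartAt I x x ∈ (extChartAt I x).target := mem_extChartAt_target x
  set u₀ : chartTarget I x := ⟨extChartAt I x x, hu0⟩ with hu₀def
  have hΦu₀ : chartInv I x u₀ = x := extChartAt_to_inv x
  have ha' : ContMDiffAt I 𝓘(ℝ, ℝ) 2 a (chartInv I x u₀) := by rw [hΦu₀]; exact ha
  have hb' : ContMDiffAt I 𝓘(ℝ, ℝ) 2 b (chartInv I x u₀) := by rw [hΦu₀]; exact hb
  have hab' : ContMDiffAt I 𝓘(ℝ, ℝ) 2 (fun y ↦ a y * b y) (chartInv I x u₀) := ha'.mul hb'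
  -- the representatives are `C²` at `φ x`
  have hsymm : ContMDiffAt 𝓘(ℝ, E) I 2 (extChartAt I x).symm (extChartAt I x x) :=
    (contMDiffOn_extChartAt_symm x).contMDiffAt ((isOpen_extChartAt_target x).mem_nhds hu0)
  have hra : ContDiffAt ℝ 2 (a ∘ (extChartAt I x).symm) (extChartAt I x x) :=
    contMDiffAt_iff_contDiffAt.1 (ha'.comp (extChartAt I x x) hsymm)
  have hrb : ContDiffAt ℝ 2 (b ∘ (extChartAt I x).symm) (extChartAt I x x) :=
    contMDiffAt_iff_contDiffAt.1 (hb'.comp (extChartAt I x x) hsymm)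
  -- the three Laplacians and `g⁻¹(da, db)` read in the chart
  have h1 := dalembertian_chartInv_eq g x u₀ hab'
  have h2 := dalembertian_chartInv_eq g x u₀ ha'
  have h3 := dalembertian_chartInv_eq g x u₀ hb'
  have h4 := innerDual_chartInv_eq g x u₀ (ha'.mdifferentiableAt (by norm_num))
    (hb'.mdifferentiableAt (by norm_num))
  rw [hΦu₀] at h1 h2 h3 h4
  rw [h1, h2, h3, h4]
  have hrep : ((fun y ↦ a y * b y) ∘ (extChartAt I x).symm) =
      fun z ↦ (a ∘ (extChartAt I x).symm) z * (b ∘ (extChartAt I x).symm) z := rfl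
  rw [hrep, MetricCoord.lapAt_mul G (hGm.isInvertible _ hu0) (hGm.symm _ hu0) hra hrb]
  simp only [Function.comp_apply, extChartAt_to_inv]
  ring

/-- **Conjugation by `e^{V/2}` turns the potential into the drift**: if `w` is `C²` at `x` in
space and `r ↦ w(r, x)` has derivative `Δw(s,·)(x) − Q(x) w(s, x)` within `S` at `s`, where
`Q = ¼|∇V|² − ½ΔV`, then `u = e^{V/2} w` has derivative `Δu(s,·)(x) − g⁻¹(dV, du(s,·))(x)` within
`S` at `s` (`Δ(e^{V/2}w) = e^{V/2}Δw + wΔe^{V/2} + 2g⁻¹(de^{V/2}, dw)`,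
`Δe^{V/2} = e^{V/2}(¼|∇V|² + ½ΔV)`, `de^{V/2} = ½e^{V/2}dV`). [folklore] -/
theorem heatDrift_of_potential {V : M → ℝ} (hV : ContMDiff I 𝓘(ℝ, ℝ) ∞ V) {w : ℝ → M → ℝ}
    {S : Set ℝ} {s : ℝ} {x : M} (hws : ContMDiffAt I 𝓘(ℝ, ℝ) 2 (w s) x)
    (hd : HasDerivWithinAt (fun r ↦ w r x)
      (g.dalembertian (w s) x - (g.gradSq V x / 4 - g.dalembertian V x / 2) * w s x) S s) :
    HasDerivWithinAt (fun r ↦ Real.exp (V x / 2) * w r x)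
      (g.dalembertian (fun y ↦ Real.exp (V y / 2) * w s y) x
        - g.innerDual x (mvfderiv I V x : TangentSpace I x →ₗ[ℝ] ℝ)
            (mvfderiv I (fun y ↦ Real.exp (V y / 2) * w s y) x : TangentSpace I x →ₗ[ℝ] ℝ))
      S s := by
  have h := hd.const_mul (Real.exp (V x / 2))
  -- the ingredients
  have hV2 : ContMDiffAt I 𝓘(ℝ, ℝ) 2 V x := (hV.of_le (WithTop.coe_le_coe.mpr le_top)).contMDiffAt
  have hVd : MDifferentiableAt I 𝓘(ℝ, ℝ) V x := hV.mdifferentiableAt (by simp)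
  have hwd : MDifferentiableAt I 𝓘(ℝ, ℝ) (w s) x := hws.mdifferentiableAt (by norm_num)
  have hζ : ContDiff ℝ 2 (fun t : ℝ ↦ Real.exp (t / 2)) :=
    Real.contDiff_exp.comp (contDiff_id.div_const 2)
  have hζ' : ∀ t : ℝ, HasDerivAt (fun t : ℝ ↦ Real.exp (t / 2)) (Real.exp (t / 2) / 2) t := by
    intro t
    have h1 : HasDerivAt (fun t : ℝ ↦ t / 2) (1 / 2) t := by
      simpa using (hasDerivAt_id t).div_const 2
    have h2 := h1.exp
    convert h2 using 1
    ring
  have hd1 : deriv (fun t : ℝ ↦ Real.exp (t / 2)) = fun t ↦ Real.exp (t / 2) / 2 :=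
    funext fun t ↦ (hζ' t).deriv
  have hd2 : deriv (deriv fun t : ℝ ↦ Real.exp (t / 2)) (V x) = Real.exp (V x / 2) / 4 := by
    rw [hd1]
    have h3 : HasDerivAt (fun t : ℝ ↦ Real.exp (t / 2) / 2) (Real.exp (V x / 2) / 2 / 2) (V x) :=
      (hζ' (V x)).div_const 2
    rw [h3.deriv]
    ring
  have hA : ContMDiffAt I 𝓘(ℝ, ℝ) 2 (fun y ↦ Real.exp (V y / 2)) x := hζ.contDiffAt.comp_contMDiffAt hV2
  have hAd : MDifferentiableAt I 𝓘(ℝ, ℝ) (fun y ↦ Real.exp (V y / 2)) x := hA.mdifferentiableAt (by norm_num)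
  -- `Δ e^{V/2}` and `d e^{V/2}`
  have hΔA : g.dalembertian (fun y ↦ Real.exp (V y / 2)) x =
      Real.exp (V x / 2) / 4 * g.gradSq V x + Real.exp (V x / 2) / 2 * g.dalembertian V x := by
    have h1 := g.dalembertian_real_comp (ζ := fun t : ℝ ↦ Real.exp (t / 2)) hV2 hζ.contDiffAt
    rw [show (fun y ↦ Real.exp (V y / 2)) = (fun t : ℝ ↦ Real.exp (t / 2)) ∘ V from rfl, h1, hd2,
      hd1]
    rfl
  have hdA : (mvfderiv I (fun y ↦ Real.exp (V y / 2)) x : TangentSpace I x →ₗ[ℝ] ℝ) =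
      (Real.exp (V x / 2) / 2) • (mvfderiv I V x : TangentSpace I x →ₗ[ℝ] ℝ) := by
    ext v
    simp only [ContinuousLinearMap.coe_coe, LinearMap.smul_apply, smul_eq_mul]
    exact mvfderiv_real_comp_apply (I := I) (hζ' (V x)) hVd v
  -- `Δ u` and `du`
  have hΔu := dalembertian_fun_mul g hA hws
  have hdu : (mvfderiv I (fun y ↦ Real.exp (V y / 2) * w s y) x : TangentSpace I x →ₗ[ℝ] ℝ) =
      Real.exp (V x / 2) • (mvfderiv I (w s) x : TangentSpace I x →ₗ[ℝ] ℝ)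
        + (w s x * (Real.exp (V x / 2) / 2)) • (mvfderiv I V x : TangentSpace I x →ₗ[ℝ] ℝ) := by
    have hm := mvfderiv_fun_mul hAd hwd
    apply_fun (fun L : TangentSpace I x →L[ℝ] ℝ ↦ (L : TangentSpace I x →ₗ[ℝ] ℝ)) at hm
    rw [hm, ContinuousLinearMap.toLinearMap_add, ContinuousLinearMap.toLinearMap_smul,
      ContinuousLinearMap.toLinearMap_smul, hdA, smul_smul]
  have hgV : g.innerDual x (mvfderiv I V x : TangentSpace I x →ₗ[ℝ] ℝ)
      (mvfderiv I V x : TangentSpace I x →ₗ[ℝ] ℝ) = g.gradSq V x := rfl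
  rw [hΔu, hΔA, hdA, hdu, g.innerDual_add_right, g.innerDual_smul_right, g.innerDual_smul_right,
    g.innerDual_smul_left, hgV]
  exact h.congr_deriv (by ring)

end Conjugation

/-! ### Uniqueness and gluing in time -/

section Glue

variable {E : Type*} [NormedAddCommGroup E] [NormedSpace ℝ E] [FiniteDimensional ℝ E]
  {H : Type*} [TopologicalSpace H] {I : ModelWithCorners ℝ E H} [I.Boundaryless]
  {M : Type*} [TopologicalSpace M] [ChartedSpace H M] [IsManifold I ∞ M] [CompactSpace M]
  (g : PseudoRiemannianMetric I ∞ E (TangentSpace I : M → Type _)) [g.HasLeviCivita]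

/-- **Uniqueness for the weighted heat equation on a closed manifold**: two solutions `u₁, u₂`,
smooth on `M × [0, T]` (`T > 0`), of `∂ₜu = Δu − g⁻¹(dV, du)` (derivatives within `[0, T]`) with
`u₁(0, ·) = u₂(0, ·)` coincide on `[0, T]`. Proof: `D = (u₁ − u₂)²` satisfies
`∂ₜD = ΔD − g⁻¹(dV, dD) − 2|∇(u₁ − u₂)|² ≤ ΔD + dD(−♯dV)`, `D(0) = 0`, so `D ≤ 0` by the weak
maximum principle (Topping 2006, Thm. 3.1.1). [cite: Topping2006, Thm. 3.1.1 (p. 35)] -/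
theorem heatDrift_unique (hR : g.IsRiemannian) {V : M → ℝ} {T : ℝ} (hT : 0 < T) {u₁ u₂ : ℝ → M → ℝ}
    (hu₁ : ContMDiffOn (I.prod 𝓘(ℝ, ℝ)) 𝓘(ℝ, ℝ) ∞ (fun p : M × ℝ ↦ u₁ p.2 p.1) (univ ×ˢ Icc 0 T))
    (hu₂ : ContMDiffOn (I.prod 𝓘(ℝ, ℝ)) 𝓘(ℝ, ℝ) ∞ (fun p : M × ℝ ↦ u₂ p.2 p.1) (univ ×ˢ Icc 0 T))
    (heq₁ : ∀ s ∈ Icc 0 T, ∀ x, HasDerivWithinAt (fun r ↦ u₁ r x)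
      (g.dalembertian (u₁ s) x - g.innerDual x (mvfderiv I V x : TangentSpace I x →ₗ[ℝ] ℝ)
        (mvfderiv I (u₁ s) x : TangentSpace I x →ₗ[ℝ] ℝ)) (Icc 0 T) s)
    (heq₂ : ∀ s ∈ Icc 0 T, ∀ x, HasDerivWithinAt (fun r ↦ u₂ r x)
      (g.dalembertian (u₂ s) x - g.innerDual x (mvfderiv I V x : TangentSpace I x →ₗ[ℝ] ℝ)
        (mvfderiv I (u₂ s) x : TangentSpace I x →ₗ[ℝ] ℝ)) (Icc 0 T) s)
    (h0 : u₁ 0 = u₂ 0) : ∀ s ∈ Icc 0 T, u₁ s = u₂ s := by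
  haveI : CompleteSpace E := FiniteDimensional.complete ℝ E
  have hU : UniqueDiffOn ℝ (Icc 0 T) := uniqueDiffOn_Icc hT
  -- the difference `d` and `D = d²`
  set d : ℝ → M → ℝ := fun s x ↦ u₁ s x - u₂ s x with hddef
  have hd : ContMDiffOn (I.prod 𝓘(ℝ, ℝ)) 𝓘(ℝ, ℝ) ∞ (fun p : M × ℝ ↦ d p.2 p.1) (univ ×ˢ Icc 0 T) :=
    hu₁.sub hu₂
  have hD : ContMDiffOn (I.prod 𝓘(ℝ, ℝ)) 𝓘(ℝ, ℝ) ∞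
      (fun p : M × ℝ ↦ (fun s x ↦ d s x ^ 2) p.2 p.1) (univ ×ˢ Icc 0 T) := hd.pow 2
  have hslice₁ : ∀ s ∈ Icc 0 T, ContMDiff I 𝓘(ℝ, ℝ) ∞ (u₁ s) := fun s hs ↦
    hu₁.comp_contMDiff (contMDiff_id.prodMk contMDiff_const) fun y ↦ ⟨mem_univ _, hs⟩
  have hslice₂ : ∀ s ∈ Icc 0 T, ContMDiff I 𝓘(ℝ, ℝ) ∞ (u₂ s) := fun s hs ↦
    hu₂.comp_contMDiff (contMDiff_id.prodMk contMDiff_const) fun y ↦ ⟨mem_univ _, hs⟩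
  have hsliced : ∀ s ∈ Icc 0 T, ContMDiff I 𝓘(ℝ, ℝ) ∞ (d s) := fun s hs ↦
    (hslice₁ s hs).sub (hslice₂ s hs)
  -- the differential inequality for `D`
  have hineq : ∀ s ∈ Icc 0 T, ∀ x : M,
      derivWithin (fun r ↦ (fun s x ↦ d s x ^ 2) r x) (Icc 0 T) s ≤
      ((fun _ : ℝ ↦ g) s).laplaceBeltrami ((fun s x ↦ d s x ^ 2) s) x
        + mvfderiv I ((fun s x ↦ d s x ^ 2) s) x ((fun (_ : ℝ) (y : M) ↦
            -(g.sharp y (mvfderiv I V y : TangentSpace I y →ₗ[ℝ] ℝ))) s x)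
        + (fun _ _ : ℝ ↦ (0 : ℝ)) ((fun s x ↦ d s x ^ 2) s x) s := by
    intro s hs x
    have hds : ContMDiff I 𝓘(ℝ, ℝ) ∞ (d s) := hsliced s hs
    have hds2 : ContMDiffAt I 𝓘(ℝ, ℝ) 2 (d s) x := (hds.of_le (WithTop.coe_le_coe.mpr le_top)).contMDiffAt
    have hdsd : MDifferentiableAt I 𝓘(ℝ, ℝ) (d s) x := hds.mdifferentiableAt (by simp)
    have h1s2 : ContMDiffAt I 𝓘(ℝ, ℝ) 2 (u₁ s) x :=
      ((hslice₁ s hs).of_le (WithTop.coe_le_coe.mpr le_top)).contMDiffAt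
    have h2s2 : ContMDiffAt I 𝓘(ℝ, ℝ) 2 (u₂ s) x :=
      ((hslice₂ s hs).of_le (WithTop.coe_le_coe.mpr le_top)).contMDiffAt
    have h1d : MDifferentiableAt I 𝓘(ℝ, ℝ) (u₁ s) x := (hslice₁ s hs).mdifferentiableAt (by simp)
    have h2d : MDifferentiableAt I 𝓘(ℝ, ℝ) (u₂ s) x := (hslice₂ s hs).mdifferentiableAt (by simp)
    -- the derivative of `d` and of `D`
    have hdd : HasDerivWithinAt (fun r ↦ d r x)
        (g.dalembertian (d s) x - g.innerDual x (mvfderiv I V x : TangentSpace I x →ₗ[ℝ] ℝ)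
          (mvfderiv I (d s) x : TangentSpace I x →ₗ[ℝ] ℝ)) (Icc 0 T) s := by
      have h := (heq₁ s hs x).sub (heq₂ s hs x)
      have hΔ : g.dalembertian (d s) x = g.dalembertian (u₁ s) x - g.dalembertian (u₂ s) x := by
        -- linearity of `Δ_g`, read in the chart at `x` (`MetricCoord.lapAt_sub`)
        set G := chartRep I (fun _ ↦ g) x 0 with hGdef
        have hx0 : extChartAt I x x ∈ (extChartAt I x).target := mem_extChartAt_target x
        set u₀ : chartTarget I x := ⟨extChartAt I x x, hx0⟩ with hu₀def
        have hΦu₀ : chartInv I x u₀ = x := extChartAt_to_inv x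
        have h1' : ContMDiffAt I 𝓘(ℝ, ℝ) 2 (u₁ s) (chartInv I x u₀) := by rw [hΦu₀]; exact h1s2
        have h2' : ContMDiffAt I 𝓘(ℝ, ℝ) 2 (u₂ s) (chartInv I x u₀) := by rw [hΦu₀]; exact h2s2
        have hd' : ContMDiffAt I 𝓘(ℝ, ℝ) 2 (d s) (chartInv I x u₀) := h1'.sub h2'
        have hsymm : ContMDiffAt 𝓘(ℝ, E) I 2 (extChartAt I x).symm (extChartAt I x x) :=
          (contMDiffOn_extChartAt_symm x).contMDiffAt ((isOpen_extChartAt_target x).mem_nhds hx0)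
        have hr1 : ContDiffAt ℝ 2 (u₁ s ∘ (extChartAt I x).symm) (extChartAt I x x) :=
          contMDiffAt_iff_contDiffAt.1 (h1'.comp (extChartAt I x x) hsymm)
        have hr2 : ContDiffAt ℝ 2 (u₂ s ∘ (extChartAt I x).symm) (extChartAt I x x) :=
          contMDiffAt_iff_contDiffAt.1 (h2'.comp (extChartAt I x x) hsymm)
        have e1 := dalembertian_chartInv_eq g x u₀ hd'
        have e2 := dalembertian_chartInv_eq g x u₀ h1'
        have e3 := dalembertian_chartInv_eq g x u₀ h2'
        rw [hΦu₀] at e1 e2 e3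
        rw [e1, e2, e3]
        have hrep : (d s ∘ (extChartAt I x).symm) =
            fun z ↦ (u₁ s ∘ (extChartAt I x).symm) z - (u₂ s ∘ (extChartAt I x).symm) z := rfl
        rw [hrep, MetricCoord.lapAt_sub G hr1 hr2]
      have hgrad : (mvfderiv I (d s) x : TangentSpace I x →ₗ[ℝ] ℝ) =
          (mvfderiv I (u₁ s) x : TangentSpace I x →ₗ[ℝ] ℝ)
            - (mvfderiv I (u₂ s) x : TangentSpace I x →ₗ[ℝ] ℝ) := by
        rw [show d s = u₁ s - u₂ s from rfl, mvfderiv_sub h1d h2d, ContinuousLinearMap.toLinearMap_sub]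
      rw [hΔ, hgrad, show (mvfderiv I (u₁ s) x : TangentSpace I x →ₗ[ℝ] ℝ)
          - (mvfderiv I (u₂ s) x : TangentSpace I x →ₗ[ℝ] ℝ) =
          (mvfderiv I (u₁ s) x : TangentSpace I x →ₗ[ℝ] ℝ)
            + (-1 : ℝ) • (mvfderiv I (u₂ s) x : TangentSpace I x →ₗ[ℝ] ℝ) by
            rw [neg_one_smul, sub_eq_add_neg],
        g.innerDual_add_right, g.innerDual_smul_right]
      exact h.congr_deriv (by ring)
    have hDd : HasDerivWithinAt (fun r ↦ d r x ^ 2)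
        (2 * d s x * (g.dalembertian (d s) x - g.innerDual x (mvfderiv I V x : TangentSpace I x →ₗ[ℝ] ℝ)
          (mvfderiv I (d s) x : TangentSpace I x →ₗ[ℝ] ℝ))) (Icc 0 T) s := by
      have h := hdd.mul hdd
      rw [show (fun r ↦ d r x ^ 2) = fun r ↦ d r x * d r x from funext fun r ↦ sq _]
      exact h.congr_deriv (by ring)
    -- `Δ D = 2|∇d|² + 2 d Δd` and `dD = 2 d dd`
    have hζ : ContDiffAt ℝ 2 (fun t : ℝ ↦ t ^ 2) (d s x) := (contDiff_id.pow 2).contDiffAt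
    have hΔD : g.dalembertian (fun y ↦ d s y ^ 2) x =
        2 * g.gradSq (d s) x + 2 * d s x * g.dalembertian (d s) x := by
      have h := g.dalembertian_real_comp (ζ := fun t : ℝ ↦ t ^ 2) hds2 hζ
      have hd1 : deriv (fun t : ℝ ↦ t ^ 2) = fun t ↦ 2 * t := by
        funext t; simp
      have hd2 : deriv (deriv fun t : ℝ ↦ t ^ 2) (d s x) = 2 := by
        rw [hd1]; simp
      rw [show (fun y ↦ d s y ^ 2) = (fun t : ℝ ↦ t ^ 2) ∘ d s from rfl, h, hd2, hd1]
      rfl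
    have hdD : mvfderiv I (fun y ↦ d s y ^ 2) x
        (-(g.sharp x (mvfderiv I V x : TangentSpace I x →ₗ[ℝ] ℝ))) =
        -(2 * d s x * g.innerDual x (mvfderiv I V x : TangentSpace I x →ₗ[ℝ] ℝ)
          (mvfderiv I (d s) x : TangentSpace I x →ₗ[ℝ] ℝ)) := by
      rw [mvfderiv_neg_sharp_eq]
      have hch : (mvfderiv I (fun y ↦ d s y ^ 2) x : TangentSpace I x →ₗ[ℝ] ℝ) =
          (2 * d s x) • (mvfderiv I (d s) x : TangentSpace I x →ₗ[ℝ] ℝ) := by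
        ext v
        simp only [ContinuousLinearMap.coe_coe, LinearMap.smul_apply, smul_eq_mul]
        have hp : HasDerivAt (fun t : ℝ ↦ t ^ 2) (2 * d s x) (d s x) := by
          simpa using hasDerivAt_pow 2 (d s x)
        exact mvfderiv_real_comp_apply (I := I) hp hdsd v
      rw [hch, g.innerDual_smul_right]
    have hq : 0 ≤ g.gradSq (d s) x := g.innerDual_self_nonneg hR x _
    simp only
    rw [hDd.derivWithin (hU s hs), laplaceBeltrami_eq_dalembertian, hΔD, hdD]
    nlinarith [hq]
  -- the weak maximum principle with `φ ≡ 0`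
  have hF : ContDiffOn ℝ 1 (uncurry fun _ _ : ℝ ↦ (0 : ℝ)) (univ ×ˢ Icc 0 T) := contDiffOn_const
  have hmax := weakMaximumPrinciple hT (g := fun _ ↦ g) (fun _ _ ↦ hR)
    (fun (_ : ℝ) (y : M) ↦ -(g.sharp y (mvfderiv I V y : TangentSpace I y →ₗ[ℝ] ℝ))) hF hD hineq
    (φ := fun _ ↦ (0 : ℝ)) (α := 0) (fun s _ ↦ by simpa using hasDerivWithinAt_const s (Icc 0 T) (0 : ℝ))
    rfl (fun x ↦ by simp [hddef, h0])
  intro s hs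
  funext x
  have h := hmax s hs x
  have h' : d s x ^ 2 ≤ 0 := h
  have hdx : d s x = 0 := by nlinarith [sq_nonneg (d s x)]
  simpa [hddef, sub_eq_zero] using hdx

/-- **Gluing in time**: if for every `T > 0` and every smooth `h₀` the weighted heat equation has a
solution smooth on `M × [0, T]` with `u(0) = h₀`, then for every smooth `h₀` it has a solution
smooth on `M × [0, ∞)` (solutions on `[0, n + 1]`, `n ∈ ℕ`, agree on overlaps by
`heatDrift_unique`; `u(t) = u_{⌊t⌋}(t)` is locally one of them). [folklore] -/
theorem heatDrift_global_of_finite (hR : g.IsRiemannian) {V : M → ℝ}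
    (hfin : ∀ T : ℝ, 0 < T → ∀ h₀ : M → ℝ, ContMDiff I 𝓘(ℝ, ℝ) ∞ h₀ →
      ∃ u : ℝ → M → ℝ,
        ContMDiffOn (I.prod 𝓘(ℝ, ℝ)) 𝓘(ℝ, ℝ) ∞ (fun p : M × ℝ ↦ u p.2 p.1) (univ ×ˢ Icc 0 T) ∧
        u 0 = h₀ ∧
        ∀ s ∈ Icc 0 T, ∀ x, HasDerivWithinAt (fun r ↦ u r x)
          (g.dalembertian (u s) x - g.innerDual x (mvfderiv I V x : TangentSpace I x →ₗ[ℝ] ℝ)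
            (mvfderiv I (u s) x : TangentSpace I x →ₗ[ℝ] ℝ)) (Icc 0 T) s)
    (h₀ : M → ℝ) (hh₀ : ContMDiff I 𝓘(ℝ, ℝ) ∞ h₀) :
    ∃ u : ℝ → M → ℝ,
      ContMDiffOn (I.prod 𝓘(ℝ, ℝ)) 𝓘(ℝ, ℝ) ∞ (fun p : M × ℝ ↦ u p.2 p.1) (univ ×ˢ Ici 0) ∧
      u 0 = h₀ ∧
      (∀ t ∈ Ici (0 : ℝ), ∀ x, derivWithin (fun s ↦ u s x) (Ici 0) t =
        g.dalembertian (u t) x - g.innerDual x (mvfderiv I V x : TangentSpace I x →ₗ[ℝ] ℝ)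
          (mvfderiv I (u t) x : TangentSpace I x →ₗ[ℝ] ℝ)) := by
  have hpos : ∀ n : ℕ, (0 : ℝ) < n + 1 := fun n ↦ by positivity
  choose U hU hU0 hUeq using fun n : ℕ ↦ hfin ((n : ℝ) + 1) (hpos n) h₀ hh₀
  -- the solutions agree on overlaps
  have hagree : ∀ n N : ℕ, n ≤ N → ∀ s ∈ Icc (0 : ℝ) (n + 1), U n s = U N s := by
    intro n N hnN s hs
    have hsub : Icc (0 : ℝ) (n + 1) ⊆ Icc (0 : ℝ) (N + 1) :=
      Icc_subset_Icc le_rfl (by exact_mod_cast Nat.succ_le_succ hnN)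
    refine heatDrift_unique g hR (hpos n) (hU n) ((hU N).mono (prod_mono le_rfl hsub)) (hUeq n)
      (fun s hs x ↦ ((hUeq N) s (hsub hs) x).mono hsub) ?_ s hs
    rw [hU0 n, hU0 N]
  -- the glued function
  set u : ℝ → M → ℝ := fun s x ↦ U ⌊s⌋₊ s x with hudef
  have hloc : ∀ N : ℕ, ∀ s ∈ Ico (0 : ℝ) (N + 1), u s = U N s := by
    intro N s hs
    have hs2 : s < ((N + 1 : ℕ) : ℝ) := by push_cast; exact hs.2
    have hn : ⌊s⌋₊ ≤ N := Nat.lt_succ_iff.1 ((Nat.floor_lt hs.1).2 hs2)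
    have hs' : s ∈ Icc (0 : ℝ) (⌊s⌋₊ + 1) := ⟨hs.1, (Nat.lt_floor_add_one s).le⟩
    exact hagree _ _ hn s hs'
  -- neighbourhoods
  have hnhds : ∀ t ∈ Ici (0 : ℝ), Ico (0 : ℝ) ((⌊t⌋₊ + 1 : ℕ) + 1) ∈ 𝓝[Ici 0] t := by
    intro t ht
    have hlt : t < ((⌊t⌋₊ + 1 : ℕ) : ℝ) + 1 := by
      push_cast
      linarith [Nat.lt_floor_add_one t]
    have : Ici (0 : ℝ) ∩ Iio (((⌊t⌋₊ + 1 : ℕ) : ℝ) + 1) ⊆ Ico (0 : ℝ) ((⌊t⌋₊ + 1 : ℕ) + 1) :=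
      fun s hs ↦ ⟨hs.1, hs.2⟩
    exact mem_of_superset (inter_mem_nhdsWithin _ (Iio_mem_nhds hlt)) this
  have hnhdsIcc : ∀ t ∈ Ici (0 : ℝ), Icc (0 : ℝ) ((⌊t⌋₊ + 1 : ℕ) + 1) ∈ 𝓝[Ici 0] t := fun t ht ↦
    mem_of_superset (hnhds t ht) Ico_subset_Icc_self
  refine ⟨u, ?_, ?_, ?_⟩
  · -- smoothness: locally `u` is one of the `U N`
    intro p hp
    have ht : p.2 ∈ Ici (0 : ℝ) := hp.2
    set N : ℕ := ⌊p.2⌋₊ + 1 with hNdef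
    have hpN : p ∈ univ ×ˢ Icc (0 : ℝ) (N + 1) := by
      refine ⟨mem_univ _, ht, ?_⟩
      have := Nat.lt_floor_add_one p.2
      rw [hNdef]; push_cast; linarith
    have h1 : ContMDiffWithinAt (I.prod 𝓘(ℝ, ℝ)) 𝓘(ℝ, ℝ) ∞ (fun q : M × ℝ ↦ U N q.2 q.1)
        (univ ×ˢ Ici 0) p := by
      refine ((hU N) p hpN).mono_of_mem_nhdsWithin ?_
      have h := nhdsWithin_prod (s := (univ : Set M)) (t := Ici (0 : ℝ)) (a := p.1) (b := p.2)
        self_mem_nhdsWithin (hnhdsIcc p.2 ht)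
      rwa [Prod.mk.eta] at h
    refine h1.congr_of_eventuallyEq ?_ ?_
    · have h := nhdsWithin_prod (s := (univ : Set M)) (t := Ici (0 : ℝ)) (a := p.1) (b := p.2)
        self_mem_nhdsWithin (hnhds p.2 ht)
      rw [Prod.mk.eta] at h
      filter_upwards [h] with q hq
      exact congrFun (hloc N q.2 hq.2) q.1
    · have := hloc N p.2 ⟨ht, by have := Nat.lt_floor_add_one p.2; rw [hNdef]; push_cast; linarith⟩
      exact congrFun this p.1
  · -- initial value
    funext x
    simp only [hudef, Nat.floor_zero]
    exact congrFun (hU0 0) x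
  · -- the equation
    intro t ht x
    set N : ℕ := ⌊t⌋₊ + 1 with hNdef
    have htN : t ∈ Icc (0 : ℝ) (N + 1) := by
      refine ⟨ht, ?_⟩
      have := Nat.lt_floor_add_one t
      rw [hNdef]; push_cast; linarith
    have htN' : t ∈ Ico (0 : ℝ) (N + 1) := by
      refine ⟨ht, ?_⟩
      have := Nat.lt_floor_add_one t
      rw [hNdef]; push_cast; linarith
    have h1 : HasDerivWithinAt (fun r ↦ U N r x)
        (g.dalembertian (U N t) x - g.innerDual x (mvfderiv I V x : TangentSpace I x →ₗ[ℝ] ℝ)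
          (mvfderiv I (U N t) x : TangentSpace I x →ₗ[ℝ] ℝ)) (Ici 0) t :=
      ((hUeq N) t htN x).mono_of_mem_nhdsWithin (hnhdsIcc t ht)
    have h2 : HasDerivWithinAt (fun r ↦ u r x)
        (g.dalembertian (U N t) x - g.innerDual x (mvfderiv I V x : TangentSpace I x →ₗ[ℝ] ℝ)
          (mvfderiv I (U N t) x : TangentSpace I x →ₗ[ℝ] ℝ)) (Ici 0) t := by
      refine h1.congr_of_eventuallyEq ?_ ?_
      · filter_upwards [hnhds t ht] with s hs
        exact congrFun (hloc N s hs) x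
      · exact congrFun (hloc N t htN') x
    rw [h2.derivWithin (uniqueDiffOn_Ici 0 t ht), hloc N t htN']

end Glue

/-! ### From `hLP` (manifolds modelled on `ℝ^m`) to an arbitrary model space -/

section Transport

variable {E : Type*} [NormedAddCommGroup E] [NormedSpace ℝ E] [FiniteDimensional ℝ E]
  {H : Type*} [TopologicalSpace H] {I : ModelWithCorners ℝ E H} [I.Boundaryless]
  {M : Type*} [TopologicalSpace M] [ChartedSpace H M] [IsManifold I ∞ M]
  (g : PseudoRiemannianMetric I ∞ E (TangentSpace I : M → Type _)) [g.HasLeviCivita]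

/-- **The finite-time weighted heat flow on a closed manifold with an arbitrary model space, from
the linear heat-type Cauchy problem on the same manifold re-modelled on `ℝ^{dim E}`.** If, for the
model `I.transContinuousLinearEquiv e` (`e : E ≃L ℝ^{dim E}`; same charts and smooth functions)
and the transported metric `g.transportCLE e` (same scalar products, same Laplacian), the problem
`∂_s w = Δ w − Q w`, `w(0) = w₀` is solvable smoothly on `M × [0, T]` for all smooth `Q`, `w₀`
(hypothesis `hLPM`, an instance of the `hLP` of `perelman_noLocalCollapsing_of_linearHeat`), then
for every smooth `V`, `h₀` there is `u` smooth on `M × [0, T]` with `u(0) = h₀` and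
`∂ₜu = Δ_g u − g⁻¹(dV, du)` (conjugation by `e^{V/2}`, `heatDrift_of_potential`). [folklore] -/
theorem heatDrift_finite_of_linearHeat (e : E ≃L[ℝ] EuclideanSpace ℝ (Fin (finrank ℝ E)))
    [(g.transportCLE e).HasLeviCivita] {T : ℝ}
    (hLPM : ∀ Q : M → ℝ, ContMDiff (I.transContinuousLinearEquiv e) 𝓘(ℝ, ℝ) ∞ Q →
      ∀ w₀ : M → ℝ, ContMDiff (I.transContinuousLinearEquiv e) 𝓘(ℝ, ℝ) ∞ w₀ →
        ∃ w : ℝ → M → ℝ,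
          ContMDiffOn ((I.transContinuousLinearEquiv e).prod 𝓘(ℝ, ℝ)) 𝓘(ℝ, ℝ) ∞
            (fun p : M × ℝ ↦ w p.2 p.1) (univ ×ˢ Icc 0 T) ∧
          w 0 = w₀ ∧
          ∀ s ∈ Icc 0 T, ∀ x : M, HasDerivWithinAt (fun r ↦ w r x)
            ((g.transportCLE e).laplaceBeltrami (w s) x - Q x * w s x) (Icc 0 T) s)
    {V : M → ℝ} (hV : ContMDiff I 𝓘(ℝ, ℝ) ∞ V) (h₀ : M → ℝ) (hh₀ : ContMDiff I 𝓘(ℝ, ℝ) ∞ h₀) :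
    ∃ u : ℝ → M → ℝ,
      ContMDiffOn (I.prod 𝓘(ℝ, ℝ)) 𝓘(ℝ, ℝ) ∞ (fun p : M × ℝ ↦ u p.2 p.1) (univ ×ˢ Icc 0 T) ∧
      u 0 = h₀ ∧
      ∀ s ∈ Icc 0 T, ∀ x, HasDerivWithinAt (fun r ↦ u r x)
        (g.dalembertian (u s) x - g.innerDual x (mvfderiv I V x : TangentSpace I x →ₗ[ℝ] ℝ)
          (mvfderiv I (u s) x : TangentSpace I x →ₗ[ℝ] ℝ)) (Icc 0 T) s := by
  set I' := I.transContinuousLinearEquiv e with hI'def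
  have hid : ContMDiff I' I ∞ (id : M → M) := contMDiff_id_transCLE I e
  have hid' : ContMDiff I I' ∞ (id : M → M) := contMDiff_id_transCLE' I e
  -- the potential and the initial datum, smooth for the transported model
  set Q : M → ℝ := fun x ↦ g.gradSq V x / 4 - g.dalembertian V x / 2 with hQdef
  have hQ : ContMDiff I 𝓘(ℝ, ℝ) ∞ Q :=
    ((contMDiff_gradSq g hV).div_const 4).sub ((contMDiff_dalembertian g hV).div_const 2)
  have hQ' : ContMDiff I' 𝓘(ℝ, ℝ) ∞ Q := hQ.comp hid
  set w₀ : M → ℝ := fun x ↦ Real.exp (-(V x / 2)) * h₀ x with hw₀def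
  have hw₀ : ContMDiff I 𝓘(ℝ, ℝ) ∞ w₀ :=
    ((Real.contDiff_exp.comp contDiff_neg).comp_contMDiff (hV.div_const 2)).mul hh₀
  have hw₀' : ContMDiff I' 𝓘(ℝ, ℝ) ∞ w₀ := hw₀.comp hid
  obtain ⟨w, hw, hw0, hweq⟩ := hLPM Q hQ' w₀ hw₀'
  -- smoothness of `w` for the original model
  have hwI : ContMDiffOn (I.prod 𝓘(ℝ, ℝ)) 𝓘(ℝ, ℝ) ∞ (fun p : M × ℝ ↦ w p.2 p.1) (univ ×ˢ Icc 0 T) := by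
    have hmap : ContMDiff (I.prod 𝓘(ℝ, ℝ)) (I'.prod 𝓘(ℝ, ℝ)) ∞ (Prod.map (id : M → M) (id : ℝ → ℝ)) :=
      hid'.prodMap contMDiff_id
    exact hw.comp hmap.contMDiffOn fun p hp ↦ hp
  have hslice : ∀ s ∈ Icc 0 T, ContMDiff I 𝓘(ℝ, ℝ) ∞ (w s) := fun s hs ↦
    hwI.comp_contMDiff (contMDiff_id.prodMk contMDiff_const) fun y ↦ ⟨mem_univ _, hs⟩
  -- the Laplacian of the transported metric is the Laplacian of `g`
  have hweqI : ∀ s ∈ Icc 0 T, ∀ x : M, HasDerivWithinAt (fun r ↦ w r x)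
      (g.dalembertian (w s) x - Q x * w s x) (Icc 0 T) s := by
    intro s hs x
    have h := hweq s hs x
    have h2 : ContMDiffAt I 𝓘(ℝ, ℝ) 2 (w s) x :=
      ((hslice s hs).of_le (WithTop.coe_le_coe.mpr le_top)).contMDiffAt
    rwa [laplaceBeltrami_eq_dalembertian, dalembertian_transportCLE g e h2] at h
  -- conjugate by `e^{V/2}`
  refine ⟨fun s x ↦ Real.exp (V x / 2) * w s x, ?_, ?_, ?_⟩
  · exact ((Real.contDiff_exp.comp_contMDiff ((hV.comp contMDiff_fst).div_const 2)).contMDiffOn).mul hwI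
  · funext x
    simp only [hw0, hw₀def]
    rw [← mul_assoc, ← Real.exp_add, show V x / 2 + -(V x / 2) = 0 by ring, Real.exp_zero, one_mul]
  · intro s hs x
    have h2 : ContMDiffAt I 𝓘(ℝ, ℝ) 2 (w s) x :=
      ((hslice s hs).of_le (WithTop.coe_le_coe.mpr le_top)).contMDiffAt
    exact heatDrift_of_potential g hV h2 (hweqI s hs x)

end Transport

/-! ### Carrillo–Ni's Cor. 4.1 (closed case) from the linear heat-type Cauchy problem `hLP` -/

/-- **`carrilloNi_muEntropy_eq_log_shrinkerDensity` follows from the solvability of the linear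
heat-type Cauchy problem on closed manifolds modelled on `ℝ^m`** — the hypothesis `hLP` of
`perelman_noLocalCollapsing_of_linearHeat` (`PerelmanNoncollapsingLinearHeat.lean`), verbatim up
to universe names: for every family `h` of Riemannian metrics `C^∞` on `M × [0, T]`, `T > 0`, on a
closed manifold modelled on `ℝ^m`, every potential `Q` `C^∞` on `M × [0, T]` and every `C^∞`
initial datum `w₀`, the problem `∂_s w = Δ_{h(s)} w − Q w`, `w(0) = w₀` has a solution `C^∞` on
`M × [0, T]` (standard linear parabolic theory: Friedman 1964, Ch. 1, Thm. 10 and Ch. 3; Topping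
2006, Rem. 8.2.5; not in Mathlib or the tree). So Carrillo–Ni's Cor. 4.1 (closed case) and
Perelman's no local collapsing theorem rest on the same single analytic input. Proof: re-model
the manifold on `ℝ^{dim E}` (`heatDrift_finite_of_linearHeat`, static family, `Q = ¼|∇V|² − ½ΔV`,
conjugation by `e^{V/2}`), glue the finite-time solutions (`heatDrift_global_of_finite`), and
apply `carrilloNi_muEntropy_eq_log_shrinkerDensity_of_heatExistence`.
[cite: CarrilloNi2009, §3–§4 and Cor. 4.1] [cite: Topping2006, Rem. 8.2.5 and Thm. 3.1.1] -/
theorem carrilloNi_muEntropy_eq_log_shrinkerDensity_of_linearHeat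
    (hLP : ∀ {m : ℕ} {H : Type u} [TopologicalSpace H]
      (I : ModelWithCorners ℝ (EuclideanSpace ℝ (Fin m)) H) [I.Boundaryless]
      (M : Type u) [TopologicalSpace M] [T2Space M] [SecondCountableTopology M] [CompactSpace M]
      [ChartedSpace H M] [IsManifold I ∞ M] (T : ℝ), 0 < T →
      ∀ h : ℝ → PseudoRiemannianMetric I ∞ (EuclideanSpace ℝ (Fin m)) (TangentSpace I : M → Type _),
        IsContMDiffFamilyOn ∞ h (Icc 0 T) → (∀ s ∈ Icc 0 T, (h s).IsRiemannian) →
        ∀ Q : ℝ → M → ℝ,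
          ContMDiffOn (I.prod 𝓘(ℝ, ℝ)) 𝓘(ℝ, ℝ) ∞ (fun p : M × ℝ ↦ Q p.2 p.1) (univ ×ˢ Icc 0 T) →
        ∀ w₀ : M → ℝ, ContMDiff I 𝓘(ℝ, ℝ) ∞ w₀ →
          ∃ w : ℝ → M → ℝ,
            ContMDiffOn (I.prod 𝓘(ℝ, ℝ)) 𝓘(ℝ, ℝ) ∞ (fun p : M × ℝ ↦ w p.2 p.1) (univ ×ˢ Icc 0 T) ∧
            w 0 = w₀ ∧
            ∀ s ∈ Icc 0 T, ∀ x : M, HasDerivWithinAt (fun r ↦ w r x)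
              ((h s).laplaceBeltrami (w s) x - Q s x * w s x) (Icc 0 T) s) :
    carrilloNi_muEntropy_eq_log_shrinkerDensity.{u} := by
  refine carrilloNi_muEntropy_eq_log_shrinkerDensity_of_heatExistence
    fun E _ _ _ H _ I _ M _ _ _ _ _ _ _ _ g _ V h₀ hg hV hh₀ ↦ ?_
  -- re-model `M` on `ℝ^{dim E}`
  set e : E ≃L[ℝ] EuclideanSpace ℝ (Fin (finrank ℝ E)) := toEuclidean with hedef
  haveI : (I.transContinuousLinearEquiv e).Boundaryless := boundaryless_transCLE I e
  haveI : (g.transportCLE e).HasLeviCivita := (g.transportCLE e).hasLeviCivita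
  haveI : SecondCountableTopology H := I.secondCountableTopology
  haveI : SecondCountableTopology M := ChartedSpace.secondCountable_of_sigmaCompact H M
  have hgR : (g.transportCLE e).IsRiemannian := isRiemannian_transportCLE e hg
  refine heatDrift_global_of_finite g hg (fun T hT k₀ hk₀ ↦ ?_) h₀ hh₀
  refine heatDrift_finite_of_linearHeat g e (T := T) (fun Q hQ w₀ hw₀ ↦ ?_) hV k₀ hk₀
  obtain ⟨w, hw, hw0, hweq⟩ := hLP (I.transContinuousLinearEquiv e) M T hT
    (fun _ ↦ g.transportCLE e) (isContMDiffFamilyOn_const _ _) (fun _ _ ↦ hgR)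
    (fun _ ↦ Q) ((hQ.comp contMDiff_fst).contMDiffOn) w₀ hw₀
  exact ⟨w, hw, hw0, hweq⟩

/-! ### The static, arbitrary-model form of the remaining input -/

section Static

variable {E : Type*} [NormedAddCommGroup E] [NormedSpace ℝ E] [FiniteDimensional ℝ E]
  {H : Type*} [TopologicalSpace H] {I : ModelWithCorners ℝ E H} [I.Boundaryless]
  {M : Type*} [TopologicalSpace M] [ChartedSpace H M] [IsManifold I ∞ M]
  (g : PseudoRiemannianMetric I ∞ E (TangentSpace I : M → Type _)) [g.HasLeviCivita]

/-- **The finite-time weighted heat flow from the static linear problem on the same model**: if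
for the metric `g` itself (no re-modelling) the problem `∂_s w = Δ_g w − Q w`, `w(0) = w₀` is
solvable smoothly on `M × [0, T]` for all smooth `Q`, `w₀` (hypothesis `hLPM`), then for every
smooth `V`, `h₀` there is `u` smooth on `M × [0, T]` with `u(0) = h₀` and
`∂ₜu = Δ_g u − g⁻¹(dV, du)` (conjugation by `e^{V/2}`, `heatDrift_of_potential`). [folklore] -/
theorem heatDrift_finite_of_staticLinearHeat {T : ℝ}
    (hLPM : ∀ Q : M → ℝ, ContMDiff I 𝓘(ℝ, ℝ) ∞ Q → ∀ w₀ : M → ℝ, ContMDiff I 𝓘(ℝ, ℝ) ∞ w₀ →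
      ∃ w : ℝ → M → ℝ,
        ContMDiffOn (I.prod 𝓘(ℝ, ℝ)) 𝓘(ℝ, ℝ) ∞ (fun p : M × ℝ ↦ w p.2 p.1) (univ ×ˢ Icc 0 T) ∧
        w 0 = w₀ ∧
        ∀ s ∈ Icc 0 T, ∀ x : M, HasDerivWithinAt (fun r ↦ w r x)
          (g.dalembertian (w s) x - Q x * w s x) (Icc 0 T) s)
    {V : M → ℝ} (hV : ContMDiff I 𝓘(ℝ, ℝ) ∞ V) (h₀ : M → ℝ) (hh₀ : ContMDiff I 𝓘(ℝ, ℝ) ∞ h₀) :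
    ∃ u : ℝ → M → ℝ,
      ContMDiffOn (I.prod 𝓘(ℝ, ℝ)) 𝓘(ℝ, ℝ) ∞ (fun p : M × ℝ ↦ u p.2 p.1) (univ ×ˢ Icc 0 T) ∧
      u 0 = h₀ ∧
      ∀ s ∈ Icc 0 T, ∀ x, HasDerivWithinAt (fun r ↦ u r x)
        (g.dalembertian (u s) x - g.innerDual x (mvfderiv I V x : TangentSpace I x →ₗ[ℝ] ℝ)
          (mvfderiv I (u s) x : TangentSpace I x →ₗ[ℝ] ℝ)) (Icc 0 T) s := by
  set Q : M → ℝ := fun x ↦ g.gradSq V x / 4 - g.dalembertian V x / 2 with hQdef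
  have hQ : ContMDiff I 𝓘(ℝ, ℝ) ∞ Q :=
    ((contMDiff_gradSq g hV).div_const 4).sub ((contMDiff_dalembertian g hV).div_const 2)
  set w₀ : M → ℝ := fun x ↦ Real.exp (-(V x / 2)) * h₀ x with hw₀def
  have hw₀ : ContMDiff I 𝓘(ℝ, ℝ) ∞ w₀ :=
    ((Real.contDiff_exp.comp contDiff_neg).comp_contMDiff (hV.div_const 2)).mul hh₀
  obtain ⟨w, hw, hw0, hweq⟩ := hLPM Q hQ w₀ hw₀
  have hslice : ∀ s ∈ Icc 0 T, ContMDiff I 𝓘(ℝ, ℝ) ∞ (w s) := fun s hs ↦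
    hw.comp_contMDiff (contMDiff_id.prodMk contMDiff_const) fun y ↦ ⟨mem_univ _, hs⟩
  refine ⟨fun s x ↦ Real.exp (V x / 2) * w s x, ?_, ?_, ?_⟩
  · exact ((Real.contDiff_exp.comp_contMDiff ((hV.comp contMDiff_fst).div_const 2)).contMDiffOn).mul hw
  · funext x
    simp only [hw0, hw₀def]
    rw [← mul_assoc, ← Real.exp_add, show V x / 2 + -(V x / 2) = 0 by ring, Real.exp_zero, one_mul]
  · intro s hs x
    have h2 : ContMDiffAt I 𝓘(ℝ, ℝ) 2 (w s) x :=
      ((hslice s hs).of_le (WithTop.coe_le_coe.mpr le_top)).contMDiffAt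
    exact heatDrift_of_potential g hV h2 (hweq s hs x)

end Static

/-- **`carrilloNi_muEntropy_eq_log_shrinkerDensity` from the STATIC linear heat-type Cauchy
problem on closed manifolds with an arbitrary model space** — the weakest form of the remaining
input along this line, for whichever existence theorem lands first: for `g` Riemannian on a closed
connected manifold (any finite-dimensional model space, all types in one universe), every smooth
potential `Q`, every smooth `w₀` and every `T > 0`, the problem `∂_s w = Δ_g w − Q w`, `w(0) = w₀`
has a solution `C^∞` on `M × [0, T]` (the special case `h ≡ g` of the `hLP` of
`perelman_noLocalCollapsing_of_linearHeat`, without re-modelling on `ℝ^m`). Proof: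
`heatDrift_finite_of_staticLinearHeat`, `heatDrift_global_of_finite`,
`carrilloNi_muEntropy_eq_log_shrinkerDensity_of_heatExistence`.
[cite: CarrilloNi2009, §3–§4 and Cor. 4.1] -/
theorem carrilloNi_muEntropy_eq_log_shrinkerDensity_of_staticLinearHeat
    (hLPs : ∀ (E : Type u) [NormedAddCommGroup E] [NormedSpace ℝ E] [FiniteDimensional ℝ E]
      (H : Type u) [TopologicalSpace H] (I : ModelWithCorners ℝ E H) [I.Boundaryless]
      (M : Type u) [TopologicalSpace M] [ChartedSpace H M] [IsManifold I ∞ M] [T3Space M]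
      [MeasurableSpace M] [BorelSpace M] [CompactSpace M] [ConnectedSpace M]
      (g : PseudoRiemannianMetric I ∞ E (TangentSpace I : M → Type _)) [g.HasLeviCivita]
      (T : ℝ), 0 < T → g.IsRiemannian →
      ∀ Q : M → ℝ, ContMDiff I 𝓘(ℝ, ℝ) ∞ Q →
      ∀ w₀ : M → ℝ, ContMDiff I 𝓘(ℝ, ℝ) ∞ w₀ →
        ∃ w : ℝ → M → ℝ,
          ContMDiffOn (I.prod 𝓘(ℝ, ℝ)) 𝓘(ℝ, ℝ) ∞ (fun p : M × ℝ ↦ w p.2 p.1) (univ ×ˢ Icc 0 T) ∧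
          w 0 = w₀ ∧
          ∀ s ∈ Icc 0 T, ∀ x : M, HasDerivWithinAt (fun r ↦ w r x)
            (g.dalembertian (w s) x - Q x * w s x) (Icc 0 T) s) :
    carrilloNi_muEntropy_eq_log_shrinkerDensity.{u} :=
  carrilloNi_muEntropy_eq_log_shrinkerDensity_of_heatExistence
    fun E _ _ _ H _ I _ M _ _ _ _ _ _ _ _ g _ _V h₀ hg hV hh₀ ↦
      heatDrift_global_of_finite g hg
        (fun T hT k₀ hk₀ ↦ heatDrift_finite_of_staticLinearHeat g (T := T)
          (fun Q hQ w₀ hw₀ ↦ hLPs E H I M g T hT hg Q hQ w₀ hw₀) hV k₀ hk₀) h₀ hh₀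

/-! ### The same from the `∂ₛw = Δ_{h(s)} w + c w` / `derivWithin` form of the linear theorem -/

/-- **`carrilloNi_muEntropy_eq_log_shrinkerDensity` from the linear parabolic existence theorem in
the form `hLH` of `perelman_noLocalCollapsing_of_linearParabolic_existence`**
(`PerelmanNoncollapsingLinearParabolic.lean`, verbatim up to universe names): on every closed
manifold modelled on `ℝ^m`, for every `T > 0`, every family `h` of Riemannian metrics `C^∞` on
`M × [0, T]`, every `c` `C^∞` on `M × [0, T]` and every `C^∞` datum `w₀`, the problem
`∂ₛw = Δ_{h(s)} w + c w`, `w(0) = w₀` has a solution `C^∞` on `M × [0, T]`, the equation holding for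
the one-sided `derivWithin` in `[0, T]`. This is the second currency in which the tree states the one
missing theorem of linear parabolic theory (Topping 2006, Rem. 8.2.5; Friedman 1964, Ch. 1 and
Ch. 3); it gives the `hLP` form of `carrilloNi_muEntropy_eq_log_shrinkerDensity_of_linearHeat` with
`c = −Q` (a function `C^∞` on `M × [0, T]` has the one-sided time derivative `derivWithin`,
`hasDerivWithinAt_time_of_contMDiffOn`). So whichever form lands first discharges both
Carrillo–Ni's Cor. 4.1 (closed case) and Perelman's no local collapsing theorem.
[cite: CarrilloNi2009, §3–§4 and Cor. 4.1] [cite: Topping2006, Rem. 8.2.5] -/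
theorem carrilloNi_muEntropy_eq_log_shrinkerDensity_of_linearParabolic
    (hLH : ∀ (m : ℕ) {H : Type u} [TopologicalSpace H]
      (I : ModelWithCorners ℝ (EuclideanSpace ℝ (Fin m)) H) [I.Boundaryless]
      (M : Type u) [TopologicalSpace M] [T2Space M] [SecondCountableTopology M] [CompactSpace M]
      [ChartedSpace H M] [IsManifold I ∞ M] (T : ℝ), 0 < T →
      ∀ (h : ℝ → PseudoRiemannianMetric I ∞ (EuclideanSpace ℝ (Fin m)) (TangentSpace I : M → Type _)),
        IsContMDiffFamilyOn ∞ h (Icc 0 T) → (∀ s ∈ Icc 0 T, (h s).IsRiemannian) →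
        ∀ c : ℝ → M → ℝ,
          ContMDiffOn (I.prod 𝓘(ℝ, ℝ)) 𝓘(ℝ, ℝ) ∞ (fun p : M × ℝ ↦ c p.2 p.1) (univ ×ˢ Icc 0 T) →
        ∀ w₀ : M → ℝ, ContMDiff I 𝓘(ℝ, ℝ) ∞ w₀ →
          ∃ w : ℝ → M → ℝ, w 0 = w₀ ∧
            ContMDiffOn (I.prod 𝓘(ℝ, ℝ)) 𝓘(ℝ, ℝ) ∞ (fun p : M × ℝ ↦ w p.2 p.1) (univ ×ˢ Icc 0 T) ∧
            ∀ s ∈ Icc 0 T, ∀ x, derivWithin (fun r ↦ w r x) (Icc 0 T) s =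
              (h s).laplaceBeltrami (w s) x + c s x * w s x) :
    carrilloNi_muEntropy_eq_log_shrinkerDensity.{u} := by
  refine carrilloNi_muEntropy_eq_log_shrinkerDensity_of_linearHeat
    fun {m} {H} _ I _ M _ _ _ _ _ _ T hT h hh hR Q hQ w₀ hw₀ ↦ ?_
  -- solve `∂ₛw = Δ_{h(s)} w + (−Q) w`
  obtain ⟨w, hw0, hw, hwpde⟩ := hLH m I M T hT h hh hR (fun s x ↦ -Q s x) hQ.neg w₀ hw₀
  refine ⟨w, hw, hw0, fun s hs x ↦ ?_⟩
  -- the smooth solution has the one-sided time derivative `derivWithin`, given by the equation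
  have hd := hasDerivWithinAt_time_of_contMDiffOn (k := ∞) (by simp) hw x hs
  rw [hwpde s hs x] at hd
  exact hd.congr_deriv (by ring)

end Literature.Geometry.Riemannian


end
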